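import Summits.QuantumFields.YangMills.Theorems.BalabanUVNodesN26AtRecord13Sep
import Summits.QuantumFields.YangMills.Theorems.BalabanUVNodesN28SideConditions
import Summits.QuantumFields.BalabanUV.Gaps.EndRunwiseHeadline

/-!
# DAG node N26 ∕ crux K2⁗ — K2⁗'s CONSEQUENT AT θ IN THE CHAIN-FREE β-CURRENCIES OF THE GAPS CELL, keyed at the Stage-13 β of record
# `Node00.betaOfRecord₁₃ F N θ`, with B4 (= N26) a STAND-ALONE antecedent and the hypotheses UNFOLDED ON THE MERGED β (no `beta0OfMerged`, no split, no jets, no chain)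

Cell `pub-ymgap`, YM-PLAN Track A (HUMAN RULING D-0062), seat `pub-ymgap-dag-n26-c` gen 9 (R134 acceleration seat, s2); helper for crux K2⁗ `EndpointGivenBR13Sep`
(stmt-QuantumFields-20291; after plan rev 20 its token-mapped successor).  COMPANION of this lineage's `…N26AtRecord13Sep` (p504252): there K2⁗'s consequent
`DagBinding.EndpointExistence (datumOfRecord₁₃Sep F N θ hP).C.toB12` (∧ N26's literal) is derived at θ from the REGISTERED pair's currency — a (D1) drift of the
record's one-loop numbers `β⁰_θ` + the rows-(D4) ∧ B4 residue `Gaps.BetaContFromD4Chain.AtSlopeCont` (an INHABITANT of `ChainTFac190H` for the record's split,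
carrying (C-pt)).  The gaps cell's END files (`Gaps/EndRunwiseCone`, `EndRunwiseShooting`, `EndRunwiseHeadline`, seat g1-p3 gen 6; `Beta/DriftRemainder`;
N28's `…N28SideConditions`) prove the endpoint half of [I] Thm 2 from WEAKER, CHAIN-FREE β-side hypotheses at construction ∕ datum level.  This module keys
them at the Stage-13 β of record, GENERIC IN THE DATUM (`D` with `hD : D.βfun = betaOfRecord₁₃ F N θ`, so `datumOfRecord₁₃Sep θ hP` — and any later
re-keyed datum with the same β — is an instance by `rfl`), and UNFOLDS every hypothesis on a box `γ₀ ≤ θ.γ` onto the MERGED β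
`β_m := betaMerged F (mergedTermFamilyMatT F N (TcanOfRecord F N) (chiFixed29 F N θ.ν θ.ε₂₉) θ.εbg) θ.ρ8 θ.bV` (on the box the β of record IS `β_m`,
`Node00.betaOfMerged_of_mem`):

WHAT IS HERE (0 `def`, 0 `sorry`; every proof a rewrite on the box + ONE application of a landed theorem, BY NAME):
* §0 `betaOfRecord₁₃_apply_of_mem_box` (on `]0,γ₀]^{k+1}`, `γ₀ ≤ θ.γ`: `betaOfRecord₁₃ θ k v = β_m k v`), `betaUpperH_betaOfRecord₁₃_iff` ((U) on the box ⟺ `β_m ≤ β'` there),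
  `prefixOf_mem_box_of_le`, `remainderConst_split₁₃_iff` (`RemainderConst (split₁₃ θ) γ₀ r` ⟺ `|β_m k v − β⁰_θ k| ≤ r` on the box).
* §1 (datum-generic, `hD : D.βfun = betaOfRecord₁₃ F N θ`) K2⁗'s consequent ∧ N26's literal at `D` from: (a) `endpoint_and_n26_of_monotoneSign₁₃` — B4 on `]0,γ₀]` + (U) + the
  SIGN `0 ≤ β` at non-decreasing in-box histories (`Gaps.EndRunwiseCone.endpointExistence_of_monotoneSign`); (b) `…_of_runwisePS₁₃` — B4 + (U) + run-wise (PS)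
  (`Gaps.EndRunwiseShooting.endpointExistence_of_runwisePS`); (c) `…_of_topRuns₁₃` (`Gaps.EndRunwiseHeadline.endpointExistence_of_topRunsGstar`); (d)
  `…_of_literalBinders₁₃` — (B3) `BetaPertH β̄` + (B4) (N28's `betaPertHyp_of_literalBinders` ∘ `T4Continuum.endpointExistence_of_betaPertHyp`); (e)
  `…_of_drift_remainderConst_betaContH₁₃` — drift of `β⁰_θ` + `RemainderConst (split₁₃ θ) γ₀ r`, `r ≤ d`, + B4 (`Beta.DriftRemainder.endpointExistence_of_drift_remainderConst_cont`):
  the registered pair's road WITHOUT the chain inhabitant (`AtSlopeCont` ⟹ both inputs: `endpoint_and_n26_of_drift_atSlopeCont₁₃'`).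
* §2 ★ THE MERGED-β FORMS: `endpoint_and_n26_of_merged_cont_upper_sign₁₃` — K2⁗'s consequent ∧ N26 at `D` from THREE sentences about `β_m` on `]0,γ₀]^{k+1}` (`0 < γ₀ ≤ θ.γ`):
  per-`k` `ContinuousOn`, `β_m ≤ β'`, `0 ≤ β_m` at non-decreasing histories — NO `beta0OfMerged` (`limUnder (𝓝[>] 0)`), NO split, NO jets, NO `ChainTFac190H`;
  `endpoint_and_n26_of_merged_drift_remainder_cont₁₃` — road (e) with the remainder bound read on `β_m − β⁰_θ`.
* §3 instances at def-T's v1.2 datum `datumOfRecord₁₃Sep θ hP` (`hD := βfun_datumOfRecord₁₃Sep`, `rfl`): `endpoint_and_n26_datumOfRecord₁₃Sep_of_monotoneSign` ∕ `_of_literalBinders` ∕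
  `_of_drift_remainderConst_betaContH` ∕ `_of_merged_cont_upper_sign`.
* §3′ the same two headline instances at def-T's bg-free CORE datum `datumOfRecord₁₃Core θ hc` (plan g67 CORE-YES: consumer storeys key ONCE on Core; every item edition's
  datum is the Core datum at `h.toCore` by `rfl`): `endpoint_and_n26_datumOfRecord₁₃Core_of_monotoneSign` ∕ `_of_merged_cont_upper_sign`.
* §4 `k2Consequent₁₃Sep_of_chainFreeSign` — the ∀θ-form: the ⁗ route decl's BODY (N = 2, namespaces opened; no `Theses` import) from the ∀θ merged sign-triple; the crux's unity,
  (B) and window hypotheses unused on this road (as on the registered one).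

HONEST FRAMING.  Reductions between displayed predicates, kernel-checked; EVERY antecedent (B4, (U), the sign, (PS), top runs, (B3), the drift, the remainder bound) is a
HYPOTHESIS on the record's β proved NOWHERE in the tree (instance 0∕1 for Bałaban's objects); nothing of Bałaban's analysis asserted; K2⁗ ∕ `stub_d1Residue13` ∕
`stub_d4AtSlopeCont13` NOT proved; N25 ∕ N26 NOT discharged (N26 VACATED ∕ (D4)-dependent; counts unmoved 5∕27 · A 5∕28); general `N`; one finite four-torus programme at fixed
ε per run — NOT the continuum limit, NOT ℝ⁴, NOT OS, NOT a mass gap, NOT Clay.  No `instance`, no `notation`, no `axiom`.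
Sources (context): [I] = [Balaban1987RG1] CMP **109** (1987): Thm 2 p. 259 (first sentence; proof unpublished, [Balaban1989LargeFieldII] p. 355), (0.20) p. 256, (1.20)–(1.22)
p. 264, (2.12)–(2.14) p. 268; [II] = [Balaban1988RG2Cluster] CMP **116** (1988): (2.41) p. 21.
-/

noncomputable section

open scoped Matrix.Norms.L2Operator

namespace Summit.QuantumFields.YangMills.Theorems.BalabanUVNodesK2AtBetaOfRecord13ChainFree

open Literature.MathematicalPhysics.QuantumFieldTheory.Balaban1983to89
open Literature.MathematicalPhysics.QuantumFieldTheory.Balaban1983to89.FlowStep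
open Literature.MathematicalPhysics.QuantumFieldTheory.Balaban1983to89.DagBinding (EndpointExistence ForwardGenerated)
open Literature.MathematicalPhysics.QuantumFieldTheory.Balaban1983to89.T4Continuum (T4Family FiniteEpsData endpointExistence_of_betaPertHyp)
open Literature.MathematicalPhysics.QuantumFieldTheory.Balaban1983to89.Node00
open Literature.MathematicalPhysics.QuantumFieldTheory.Balaban1983to89.Beta.Drift (OneLoopDrift)
open Literature.MathematicalPhysics.QuantumFieldTheory.Balaban1983to89.Beta.RemainderChain (RemainderConst)
open Literature.MathematicalPhysics.QuantumFieldTheory.Balaban1983to89.Beta.DriftRemainder (endpointExistence_of_drift_remainderConst_cont)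
open Summit.QuantumFields.BalabanUV.Gaps.BetaContFromD4Chain (AtSlopeCont remainderConst_of_atSlopeCont betaContH_of_atSlopeCont)
open Summit.QuantumFields.BalabanUV.Gaps.EndRunwiseCone (endpointExistence_of_monotoneSign)
open Summit.QuantumFields.BalabanUV.Gaps.EndRunwiseShooting (endpointExistence_of_runwisePS)
open Summit.QuantumFields.BalabanUV.Gaps.EndRunwiseHeadline (endpointExistence_of_topRunsGstar)
open Summit.QuantumFields.YangMills.BalabanUVNodes.N28SideConditions (betaPertHyp_of_literalBinders)
open Summit.QuantumFields.YangMills.Theorems.BalabanUVNodesN26AtRecord13 (betaOfRecord₁₃_eq_betaT betaContH_betaOfRecord₁₃_iff)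
open Filter Topology

variable (F : T4Family) (N : ℕ) [NeZero N]

/-! ## §0 On a box `γ₀ ≤ θ.γ` the Stage-13 β of record IS the merged β: (U), the sign and the remainder bound read on `β_m` -/

section Box

variable (θ : Stage13Params F N)

/-- **On `]0,γ₀]^{k+1}` with `γ₀ ≤ θ.γ` the Stage-13 β of record IS the merged β** `β_m k v` (`betaOfRecord₁₃ = betaOfMerged β_m β⁰ θ.γ`, `rfl`; `Node00.betaOfMerged_of_mem` on the
larger box). [cite: Balaban1987RG1, (1.20)–(1.22) p.264 and (2.12)–(2.14) p.268 (bookkeeping)] -/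
theorem betaOfRecord₁₃_apply_of_mem_box {γ₀ : ℝ} (hle : γ₀ ≤ θ.γ) {k : ℕ} {v : Fin (k + 1) → ℝ} (hv : v ∈ Box γ₀ k) :
    betaOfRecord₁₃ F N θ k v =
      letI := θ.instVβ₁; letI := θ.instVβ₂; letI := θ.instιβ
      betaMerged F (mergedTermFamilyMatT F N (TcanOfRecord F N) (chiFixed29 F N θ.ν θ.ε₂₉) θ.εbg) θ.ρ8 θ.bV k v := by
  letI := θ.instVβ₁; letI := θ.instVβ₂; letI := θ.instιβ
  rw [betaOfRecord₁₃_eq_betaT]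
  exact betaOfMerged_of_mem _ _ _ (box_mono hle k hv)

/-- **(U) on the box ⟺ `β_m ≤ β'` on the box** (`γ₀ ≤ θ.γ`). [cite: Balaban1987RG1, Thm 2 (0.31) p.259 (upper half, bookkeeping)] -/
theorem betaUpperH_betaOfRecord₁₃_iff {γ₀ : ℝ} (hle : γ₀ ≤ θ.γ) (β' : ℝ) :
    BetaUpperH β' γ₀ (betaOfRecord₁₃ F N θ) ↔
      letI := θ.instVβ₁; letI := θ.instVβ₂; letI := θ.instιβ
      ∀ k (v : Fin (k + 1) → ℝ), v ∈ Box γ₀ k →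
        betaMerged F (mergedTermFamilyMatT F N (TcanOfRecord F N) (chiFixed29 F N θ.ν θ.ε₂₉) θ.εbg) θ.ρ8 θ.bV k v ≤ β' := by
  refine forall_congr' fun k => forall_congr' fun v => forall_congr' fun hv => ?_
  rw [betaOfRecord₁₃_apply_of_mem_box F N θ hle hv]

omit [NeZero N] in
/-- A history with `0 < g_i ≤ γ₀` for `i ≤ k` has its prefix in the box `]0,γ₀]^{k+1}`. [folklore] -/
theorem prefixOf_mem_box {γ₀ : ℝ} {k : ℕ} {gs : ℕ → ℝ} (hgs : ∀ i, i ≤ k → 0 < gs i ∧ gs i ≤ γ₀) : prefixOf gs k ∈ Box γ₀ k :=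
  mem_box.mpr fun i => hgs i (Nat.lt_succ_iff.mp i.isLt)

/-- **The remainder bound of the record's definitional split on the box ⟺ `|β_m k v − β⁰_θ k| ≤ r` on the box** (`γ₀ ≤ θ.γ`): the split `oneLoopSplit_betaOfMerged β_m β⁰_θ θ.γ` has
`β1 k = 𝟙_{]0,θ.γ]^{k+1}}·(β_m k − β⁰_θ k)`. [cite: Balaban1987RG1, (2.12)–(2.14) p.268; Balaban1988RG2Cluster, (2.41) p.21 (bookkeeping)] -/
theorem remainderConst_split₁₃_iff {γ₀ : ℝ} (hle : γ₀ ≤ θ.γ) (r : ℝ) :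
    (letI := θ.instVβ₁; letI := θ.instVβ₂; letI := θ.instιβ
      RemainderConst
        (oneLoopSplit_betaOfMerged (betaMerged F (mergedTermFamilyMatT F N (TcanOfRecord F N) (chiFixed29 F N θ.ν θ.ε₂₉) θ.εbg) θ.ρ8 θ.bV)
          (beta0OfMerged (betaMerged F (mergedTermFamilyMatT F N (TcanOfRecord F N) (chiFixed29 F N θ.ν θ.ε₂₉) θ.εbg) θ.ρ8 θ.bV) θ.v₀) θ.γ) γ₀ r) ↔
    (letI := θ.instVβ₁; letI := θ.instVβ₂; letI := θ.instιβ
      ∀ k (v : Fin (k + 1) → ℝ), v ∈ Box γ₀ k →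
        |betaMerged F (mergedTermFamilyMatT F N (TcanOfRecord F N) (chiFixed29 F N θ.ν θ.ε₂₉) θ.εbg) θ.ρ8 θ.bV k v -
            beta0OfMerged (betaMerged F (mergedTermFamilyMatT F N (TcanOfRecord F N) (chiFixed29 F N θ.ν θ.ε₂₉) θ.εbg) θ.ρ8 θ.bV) θ.v₀ k| ≤ r) := by
  letI := θ.instVβ₁; letI := θ.instVβ₂; letI := θ.instιβ
  refine forall_congr' fun k => forall_congr' fun v => ?_
  rw [histBox_eq_box]
  refine forall_congr' fun hv => ?_
  have e : (oneLoopSplit_betaOfMerged (betaMerged F (mergedTermFamilyMatT F N (TcanOfRecord F N) (chiFixed29 F N θ.ν θ.ε₂₉) θ.εbg) θ.ρ8 θ.bV)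
        (beta0OfMerged (betaMerged F (mergedTermFamilyMatT F N (TcanOfRecord F N) (chiFixed29 F N θ.ν θ.ε₂₉) θ.εbg) θ.ρ8 θ.bV) θ.v₀) θ.γ).β1 k v =
      (Box θ.γ k).indicator (fun w => betaMerged F (mergedTermFamilyMatT F N (TcanOfRecord F N) (chiFixed29 F N θ.ν θ.ε₂₉) θ.εbg) θ.ρ8 θ.bV k w -
        beta0OfMerged (betaMerged F (mergedTermFamilyMatT F N (TcanOfRecord F N) (chiFixed29 F N θ.ν θ.ε₂₉) θ.εbg) θ.ρ8 θ.bV) θ.v₀ k) v := rfl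
  rw [e, Set.indicator_of_mem (box_mono hle k hv)]

end Box

/-! ## §1 K2⁗'s consequent ∧ N26's literal at ANY datum carrying the Stage-13 β of record, in five chain-free currencies -/

section Datum

variable (θ : Stage13Params F N) (D : FiniteEpsData F (Matrix.specialUnitaryGroup (Fin N) ℂ)) (hD : D.βfun = betaOfRecord₁₃ F N θ)
include hD

/-- **(a) FROM B4 + (U) + THE SIGN ON NON-DECREASING HISTORIES** (g1-p3's weakest β-currency, `Gaps.EndRunwiseCone.endpointExistence_of_monotoneSign` at the datum's own `fwd`): B4
on `]0,γ₀]` (N26's literal WITH its content guard `0 < γ₀`), the printed upper bound `β ≤ β'` there, and `0 ≤ β_{k+1}(g_0,…,g_k)` asked only where `0 < g_0 ≤ … ≤ g_k ≤ γ₀`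
⟹ K2⁗'s consequent `EndpointExistence D.C.toB12` ∧ N26's literal.  No (D1) drift, no split, no chain.  Instance 0∕1. [cite: Balaban1987RG1, Thm 2 p.259 (first sentence) and (0.20) p.256] -/
theorem endpoint_and_n26_of_monotoneSign₁₃ {γ₀ β' : ℝ} (hγ₀ : 0 < γ₀) (hβ' : 0 ≤ β')
    (hcont : BetaContH γ₀ (betaOfRecord₁₃ F N θ)) (hhi : BetaUpperH β' γ₀ (betaOfRecord₁₃ F N θ))
    (hsign : ∀ (k : ℕ) (gs : ℕ → ℝ), (∀ i, i ≤ k → 0 < gs i ∧ gs i ≤ γ₀) → (∀ i j, i ≤ j → j ≤ k → gs i ≤ gs j) →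
      0 ≤ betaOfRecord₁₃ F N θ k (prefixOf gs k)) :
    EndpointExistence D.C.toB12 ∧ ∃ γc : ℝ, 0 < γc ∧ BetaContH γc D.βfun := by
  refine ⟨endpointExistence_of_monotoneSign (β := betaOfRecord₁₃ F N θ) (hD ▸ D.fwd) hγ₀ hβ' hcont hhi hsign, γ₀, hγ₀, ?_⟩
  rw [hD]; exact hcont

/-- **(b) FROM B4 + (U) + RUN-WISE (PS)**: the partial sums `Σ_{j∈[k,n[} β_{j+1}` bounded below by `−M` only ALONG IN-INTERVAL RUNS of (0.20) of the record's β
(`Gaps.EndRunwiseShooting.endpointExistence_of_runwisePS`).  Instance 0∕1. [cite: Balaban1987RG1, Thm 2 p.259 (first sentence) and (0.20) p.256] -/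
theorem endpoint_and_n26_of_runwisePS₁₃ {γ₀ M β' : ℝ} (hγ₀ : 0 < γ₀) (hM : 0 ≤ M) (hβ' : 0 ≤ β')
    (hcont : BetaContH γ₀ (betaOfRecord₁₃ F N θ)) (hhi : BetaUpperH β' γ₀ (betaOfRecord₁₃ F N θ))
    (hrun : ∀ (n : ℕ) (gs : ℕ → ℝ), RGEqH n (betaOfRecord₁₃ F N θ) gs → Step.InInterval γ₀ n gs →
      ∀ k, k ≤ n → -M ≤ ∑ j ∈ Finset.Ico k n, betaOfRecord₁₃ F N θ j (prefixOf gs j)) :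
    EndpointExistence D.C.toB12 ∧ ∃ γc : ℝ, 0 < γc ∧ BetaContH γc D.βfun := by
  refine ⟨endpointExistence_of_runwisePS (β := betaOfRecord₁₃ F N θ) (hD ▸ D.fwd) hγ₀ hM hβ' hcont hhi hrun, γ₀, hγ₀, ?_⟩
  rw [hD]; exact hcont

/-- **(c) FROM B4 + (U) + THE TOP-RUN CONDITION** (per level `γ ≤ γ₀` some `g⋆ > 0` below which no in-interval run of (0.20) sitting at `γ` ends;
`Gaps.EndRunwiseHeadline.endpointExistence_of_topRunsGstar`).  Instance 0∕1. [cite: Balaban1987RG1, Thm 2 p.259 (first sentence) and (0.20) p.256] -/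
theorem endpoint_and_n26_of_topRuns₁₃ {γ₀ β' : ℝ} (hγ₀ : 0 < γ₀) (hβ' : 0 ≤ β')
    (hcont : BetaContH γ₀ (betaOfRecord₁₃ F N θ)) (hhi : BetaUpperH β' γ₀ (betaOfRecord₁₃ F N θ))
    (htop : ∀ γ : ℝ, 0 < γ → γ ≤ γ₀ → ∃ gstar : ℝ, 0 < gstar ∧
      ∀ (n : ℕ) (gs : ℕ → ℝ), RGEqH n (betaOfRecord₁₃ F N θ) gs → Step.InInterval γ n gs → ∀ k, k ≤ n → gs k = γ → gstar ≤ gs n) :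
    EndpointExistence D.C.toB12 ∧ ∃ γc : ℝ, 0 < γc ∧ BetaContH γc D.βfun := by
  refine ⟨endpointExistence_of_topRunsGstar (β := betaOfRecord₁₃ F N θ) (hD ▸ D.fwd) hγ₀ hβ' hcont hhi htop, γ₀, hγ₀, ?_⟩
  rw [hD]; exact hcont

/-- **(d) FROM THE LITERAL BINDERS (B3) `BetaPertH β̄` (`0 < β̄`) AND (B4) `BetaContH γc` (`0 < γc`)** of the T⁴ headline at the record's β (N28's road:
`BalabanUVNodesN28SideConditions.betaPertHyp_of_literalBinders` ∘ `T4Continuum.endpointExistence_of_betaPertHyp`).  Instance 0∕1. [cite: Balaban1987RG1, Thm 2 p.259 (first sentence) and (1.22) p.264] -/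
theorem endpoint_and_n26_of_literalBinders₁₃ {βbar : ℝ} (hβbar : 0 < βbar) (hP : BetaPertH (betaOfRecord₁₃ F N θ) βbar)
    {γc : ℝ} (hγc : 0 < γc) (hC : BetaContH γc (betaOfRecord₁₃ F N θ)) :
    EndpointExistence D.C.toB12 ∧ ∃ γc : ℝ, 0 < γc ∧ BetaContH γc D.βfun := by
  refine ⟨endpointExistence_of_betaPertHyp D.C.toB12 (betaOfRecord₁₃ F N θ) (betaPertHyp_of_literalBinders hβbar hP hγc hC) (hD ▸ D.fwd), γc, hγc, ?_⟩
  rw [hD]; exact hC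

/-- **(e) FROM THE DRIFT OF `β⁰_θ` + THE REMAINDER BOUND OF THE RECORD's SPLIT + B4, WITHOUT THE CHAIN**: `OneLoopDrift d A β⁰_θ`, `RemainderConst (split₁₃ θ) γ₀ r` with `r ≤ d`, and B4 on
`]0,γ₀]` ⟹ K2⁗'s consequent ∧ N26 (`Beta.DriftRemainder.endpointExistence_of_drift_remainderConst_cont` at the datum's own `fwd`).  The REGISTERED pair's road (p504252
`endpoint_and_n26_datumOfRecord₁₃Sep_of_drift_atSlopeCont`) is the instance `r := d` with both inputs read off the `ChainTFac190H` inhabitant of `AtSlopeCont`; here no inhabitant is asked.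
Instance 0∕1. [cite: Balaban1987RG1, Thm 2 p.259 (first sentence), (2.12)–(2.14) p.268; Balaban1988RG2Cluster, (2.41) p.21] -/
theorem endpoint_and_n26_of_drift_remainderConst_betaContH₁₃ {d A γ₀ r : ℝ}
    (hdrift : letI := θ.instVβ₁; letI := θ.instVβ₂; letI := θ.instιβ
      OneLoopDrift d A
        (beta0OfMerged (betaMerged F (mergedTermFamilyMatT F N (TcanOfRecord F N) (chiFixed29 F N θ.ν θ.ε₂₉) θ.εbg) θ.ρ8 θ.bV) θ.v₀))
    (hγ₀ : 0 < γ₀)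
    (hrem : letI := θ.instVβ₁; letI := θ.instVβ₂; letI := θ.instιβ
      RemainderConst
        (oneLoopSplit_betaOfMerged (betaMerged F (mergedTermFamilyMatT F N (TcanOfRecord F N) (chiFixed29 F N θ.ν θ.ε₂₉) θ.εbg) θ.ρ8 θ.bV)
          (beta0OfMerged (betaMerged F (mergedTermFamilyMatT F N (TcanOfRecord F N) (chiFixed29 F N θ.ν θ.ε₂₉) θ.εbg) θ.ρ8 θ.bV) θ.v₀) θ.γ) γ₀ r)
    (hr : r ≤ d) (hcont : BetaContH γ₀ (betaOfRecord₁₃ F N θ)) :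
    EndpointExistence D.C.toB12 ∧ ∃ γc : ℝ, 0 < γc ∧ BetaContH γc D.βfun := by
  letI := θ.instVβ₁; letI := θ.instVβ₂; letI := θ.instιβ
  refine ⟨endpointExistence_of_drift_remainderConst_cont (β := betaOfRecord₁₃ F N θ) (hD ▸ D.fwd) (oneLoopSplit_betaOfMerged _ _ _) hγ₀ hdrift hrem hr hcont,
    γ₀, hγ₀, ?_⟩
  rw [hD]; exact hcont

/-- … and the registered currency as ITS instance: `AtSlopeCont (split₁₃ θ) γ₀ d` supplies `RemainderConst … γ₀ d` and B4 on `]0,γ₀]` (`Gaps.BetaContFromD4Chain.remainderConst_of_atSlopeCont` ∕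
`betaContH_of_atSlopeCont`), so (e) at `r := d` reproduces p504252's jets-free road at any datum carrying the record's β. [cite: Balaban1988RG2Cluster, Lemma 3 (2.38) p.20 and (2.41) p.21] -/
theorem endpoint_and_n26_of_drift_atSlopeCont₁₃' {d A γ₀ : ℝ}
    (hdrift : letI := θ.instVβ₁; letI := θ.instVβ₂; letI := θ.instιβ
      OneLoopDrift d A
        (beta0OfMerged (betaMerged F (mergedTermFamilyMatT F N (TcanOfRecord F N) (chiFixed29 F N θ.ν θ.ε₂₉) θ.εbg) θ.ρ8 θ.bV) θ.v₀))
    (hγ₀ : 0 < γ₀)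
    (hres : letI := θ.instVβ₁; letI := θ.instVβ₂; letI := θ.instιβ
      AtSlopeCont
        (oneLoopSplit_betaOfMerged (betaMerged F (mergedTermFamilyMatT F N (TcanOfRecord F N) (chiFixed29 F N θ.ν θ.ε₂₉) θ.εbg) θ.ρ8 θ.bV)
          (beta0OfMerged (betaMerged F (mergedTermFamilyMatT F N (TcanOfRecord F N) (chiFixed29 F N θ.ν θ.ε₂₉) θ.εbg) θ.ρ8 θ.bV) θ.v₀) θ.γ)
        γ₀ d) :
    EndpointExistence D.C.toB12 ∧ ∃ γc : ℝ, 0 < γc ∧ BetaContH γc D.βfun :=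
  endpoint_and_n26_of_drift_remainderConst_betaContH₁₃ F N θ D hD hdrift hγ₀ (remainderConst_of_atSlopeCont hres) le_rfl (betaContH_of_atSlopeCont hres)

end Datum

/-! ## §2 ★ The merged-β forms: K2⁗'s consequent ∧ N26 from sentences about `β_m` on `]0,γ₀]^{k+1}` (`0 < γ₀ ≤ θ.γ`) -/

section Merged

variable (θ : Stage13Params F N) (D : FiniteEpsData F (Matrix.specialUnitaryGroup (Fin N) ℂ)) (hD : D.βfun = betaOfRecord₁₃ F N θ)
include hD

/-- **★ K2⁗'s CONSEQUENT ∧ N26 FROM THREE SENTENCES ABOUT THE MERGED β ON A BOX** `]0,γ₀]^{k+1}`, `0 < γ₀ ≤ θ.γ`: per-`k` history-continuity of `β_m k`, the upper bound `β_m ≤ β'`, and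
the sign `0 ≤ β_m k (g_0,…,g_k)` at non-decreasing histories `0 < g_0 ≤ … ≤ g_k ≤ γ₀` — NO `beta0OfMerged` (no `limUnder (𝓝[>] 0)` object), NO split, NO jets, NO `ChainTFac190H`
(§1 (a) with §0's unfoldings and p491248's `betaContH_betaOfRecord₁₃_iff`).  Instance 0∕1: for Bałaban's objects the three sentences are [I]'s continuity clause after (1.22), the
upper half of (0.31) and asymptotic freedom's sign, proved nowhere in the tree. [cite: Balaban1987RG1, Thm 2 p.259 (first sentence), (0.31) p.259 and (1.20)–(1.22) p.264] -/
theorem endpoint_and_n26_of_merged_cont_upper_sign₁₃ {γ₀ β' : ℝ} (hγ₀ : 0 < γ₀) (hle : γ₀ ≤ θ.γ) (hβ' : 0 ≤ β')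
    (hcont : letI := θ.instVβ₁; letI := θ.instVβ₂; letI := θ.instιβ
      ∀ k, ContinuousOn (betaMerged F (mergedTermFamilyMatT F N (TcanOfRecord F N) (chiFixed29 F N θ.ν θ.ε₂₉) θ.εbg) θ.ρ8 θ.bV k) (Box γ₀ k))
    (hhi : letI := θ.instVβ₁; letI := θ.instVβ₂; letI := θ.instιβ
      ∀ k (v : Fin (k + 1) → ℝ), v ∈ Box γ₀ k →
        betaMerged F (mergedTermFamilyMatT F N (TcanOfRecord F N) (chiFixed29 F N θ.ν θ.ε₂₉) θ.εbg) θ.ρ8 θ.bV k v ≤ β')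
    (hsign : letI := θ.instVβ₁; letI := θ.instVβ₂; letI := θ.instιβ
      ∀ (k : ℕ) (gs : ℕ → ℝ), (∀ i, i ≤ k → 0 < gs i ∧ gs i ≤ γ₀) → (∀ i j, i ≤ j → j ≤ k → gs i ≤ gs j) →
        0 ≤ betaMerged F (mergedTermFamilyMatT F N (TcanOfRecord F N) (chiFixed29 F N θ.ν θ.ε₂₉) θ.εbg) θ.ρ8 θ.bV k (prefixOf gs k)) :
    EndpointExistence D.C.toB12 ∧ ∃ γc : ℝ, 0 < γc ∧ BetaContH γc D.βfun := by
  refine endpoint_and_n26_of_monotoneSign₁₃ F N θ D hD hγ₀ hβ' ((betaContH_betaOfRecord₁₃_iff F N θ hle).2 hcont)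
    ((betaUpperH_betaOfRecord₁₃_iff F N θ hle β').2 hhi) fun k gs hgs hmono => ?_
  rw [betaOfRecord₁₃_apply_of_mem_box F N θ hle (prefixOf_mem_box hgs)]
  exact hsign k gs hgs hmono

/-- **Road (e) read on the merged β**: the drift of `β⁰_θ`, the remainder bound `|β_m k v − β⁰_θ k| ≤ r` on `]0,γ₀]^{k+1}` with `r ≤ d`, and per-`k` continuity of `β_m` there
(`0 < γ₀ ≤ θ.γ`) ⟹ K2⁗'s consequent ∧ N26.  No chain inhabitant; `β⁰_θ` enters only through its drift and as the centre of the remainder bound. Instance 0∕1.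
[cite: Balaban1987RG1, Thm 2 p.259 (first sentence) and (2.12)–(2.14) p.268; Balaban1988RG2Cluster, (2.41) p.21] -/
theorem endpoint_and_n26_of_merged_drift_remainder_cont₁₃ {d A γ₀ r : ℝ} (hγ₀ : 0 < γ₀) (hle : γ₀ ≤ θ.γ)
    (hdrift : letI := θ.instVβ₁; letI := θ.instVβ₂; letI := θ.instιβ
      OneLoopDrift d A
        (beta0OfMerged (betaMerged F (mergedTermFamilyMatT F N (TcanOfRecord F N) (chiFixed29 F N θ.ν θ.ε₂₉) θ.εbg) θ.ρ8 θ.bV) θ.v₀))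
    (hrem : letI := θ.instVβ₁; letI := θ.instVβ₂; letI := θ.instιβ
      ∀ k (v : Fin (k + 1) → ℝ), v ∈ Box γ₀ k →
        |betaMerged F (mergedTermFamilyMatT F N (TcanOfRecord F N) (chiFixed29 F N θ.ν θ.ε₂₉) θ.εbg) θ.ρ8 θ.bV k v -
            beta0OfMerged (betaMerged F (mergedTermFamilyMatT F N (TcanOfRecord F N) (chiFixed29 F N θ.ν θ.ε₂₉) θ.εbg) θ.ρ8 θ.bV) θ.v₀ k| ≤ r)
    (hr : r ≤ d)
    (hcont : letI := θ.instVβ₁; letI := θ.instVβ₂; letI := θ.instιβ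
      ∀ k, ContinuousOn (betaMerged F (mergedTermFamilyMatT F N (TcanOfRecord F N) (chiFixed29 F N θ.ν θ.ε₂₉) θ.εbg) θ.ρ8 θ.bV k) (Box γ₀ k)) :
    EndpointExistence D.C.toB12 ∧ ∃ γc : ℝ, 0 < γc ∧ BetaContH γc D.βfun :=
  endpoint_and_n26_of_drift_remainderConst_betaContH₁₃ F N θ D hD hdrift hγ₀ ((remainderConst_split₁₃_iff F N θ hle r).2 hrem) hr
    ((betaContH_betaOfRecord₁₃_iff F N θ hle).2 hcont)

end Merged

/-! ## §3 Instances at def-T's separated-range datum `datumOfRecord₁₃Sep θ hP` (`βfun_datumOfRecord₁₃Sep`, `rfl`) -/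

section AtRecordSep

variable (θ : Stage13Params F N)

/-- **K2⁗'s consequent ∧ N26 at `datumOfRecord₁₃Sep θ hP` from B4 + (U) + the sign on non-decreasing histories** (§1 (a)). Instance 0∕1; N25 ∕ N26 NOT discharged.
[cite: Balaban1987RG1, Thm 2 p.259 (first sentence); Balaban1989LargeFieldII, Thm 1 + (0.1) pp.355–356 (the record)] -/
theorem endpoint_and_n26_datumOfRecord₁₃Sep_of_monotoneSign (hP : θ.Provisos₁₃Sep F N) {γ₀ β' : ℝ} (hγ₀ : 0 < γ₀) (hβ' : 0 ≤ β')
    (hcont : BetaContH γ₀ (betaOfRecord₁₃ F N θ)) (hhi : BetaUpperH β' γ₀ (betaOfRecord₁₃ F N θ))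
    (hsign : ∀ (k : ℕ) (gs : ℕ → ℝ), (∀ i, i ≤ k → 0 < gs i ∧ gs i ≤ γ₀) → (∀ i j, i ≤ j → j ≤ k → gs i ≤ gs j) →
      0 ≤ betaOfRecord₁₃ F N θ k (prefixOf gs k)) :
    EndpointExistence (datumOfRecord₁₃Sep F N θ hP).C.toB12 ∧ ∃ γc : ℝ, 0 < γc ∧ BetaContH γc (datumOfRecord₁₃Sep F N θ hP).βfun :=
  endpoint_and_n26_of_monotoneSign₁₃ F N θ _ (βfun_datumOfRecord₁₃Sep F N θ hP) hγ₀ hβ' hcont hhi hsign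

/-- **K2⁗'s consequent ∧ N26 at `datumOfRecord₁₃Sep θ hP` from the literal binders (B3) ∧ (B4)** (§1 (d); N28's road at the v1.2 datum). Instance 0∕1.
[cite: Balaban1987RG1, Thm 2 p.259 (first sentence) and (1.22) p.264] -/
theorem endpoint_and_n26_datumOfRecord₁₃Sep_of_literalBinders (hP : θ.Provisos₁₃Sep F N) {βbar : ℝ} (hβbar : 0 < βbar)
    (hPert : BetaPertH (betaOfRecord₁₃ F N θ) βbar) {γc : ℝ} (hγc : 0 < γc) (hC : BetaContH γc (betaOfRecord₁₃ F N θ)) :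
    EndpointExistence (datumOfRecord₁₃Sep F N θ hP).C.toB12 ∧ ∃ γc : ℝ, 0 < γc ∧ BetaContH γc (datumOfRecord₁₃Sep F N θ hP).βfun :=
  endpoint_and_n26_of_literalBinders₁₃ F N θ _ (βfun_datumOfRecord₁₃Sep F N θ hP) hβbar hPert hγc hC

/-- **K2⁗'s consequent ∧ N26 at `datumOfRecord₁₃Sep θ hP` from the drift of `β⁰_θ` + the remainder bound of the record's split + B4, no chain** (§1 (e)). Instance 0∕1.
[cite: Balaban1987RG1, Thm 2 p.259 (first sentence) and (2.12)–(2.14) p.268; Balaban1988RG2Cluster, (2.41) p.21] -/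
theorem endpoint_and_n26_datumOfRecord₁₃Sep_of_drift_remainderConst_betaContH (hP : θ.Provisos₁₃Sep F N) {d A γ₀ r : ℝ}
    (hdrift : letI := θ.instVβ₁; letI := θ.instVβ₂; letI := θ.instιβ
      OneLoopDrift d A
        (beta0OfMerged (betaMerged F (mergedTermFamilyMatT F N (TcanOfRecord F N) (chiFixed29 F N θ.ν θ.ε₂₉) θ.εbg) θ.ρ8 θ.bV) θ.v₀))
    (hγ₀ : 0 < γ₀)
    (hrem : letI := θ.instVβ₁; letI := θ.instVβ₂; letI := θ.instιβ
      RemainderConst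
        (oneLoopSplit_betaOfMerged (betaMerged F (mergedTermFamilyMatT F N (TcanOfRecord F N) (chiFixed29 F N θ.ν θ.ε₂₉) θ.εbg) θ.ρ8 θ.bV)
          (beta0OfMerged (betaMerged F (mergedTermFamilyMatT F N (TcanOfRecord F N) (chiFixed29 F N θ.ν θ.ε₂₉) θ.εbg) θ.ρ8 θ.bV) θ.v₀) θ.γ) γ₀ r)
    (hr : r ≤ d) (hcont : BetaContH γ₀ (betaOfRecord₁₃ F N θ)) :
    EndpointExistence (datumOfRecord₁₃Sep F N θ hP).C.toB12 ∧ ∃ γc : ℝ, 0 < γc ∧ BetaContH γc (datumOfRecord₁₃Sep F N θ hP).βfun :=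
  endpoint_and_n26_of_drift_remainderConst_betaContH₁₃ F N θ _ (βfun_datumOfRecord₁₃Sep F N θ hP) hdrift hγ₀ hrem hr hcont

/-- **★ K2⁗'s consequent ∧ N26 at `datumOfRecord₁₃Sep θ hP` from the three merged-β sentences on `]0,γ₀]^{k+1}`** (`0 < γ₀ ≤ θ.γ`; §2). Instance 0∕1; N25 ∕ N26 NOT discharged.
[cite: Balaban1987RG1, Thm 2 p.259 (first sentence), (0.31) p.259 and (1.20)–(1.22) p.264] -/
theorem endpoint_and_n26_datumOfRecord₁₃Sep_of_merged_cont_upper_sign (hP : θ.Provisos₁₃Sep F N) {γ₀ β' : ℝ} (hγ₀ : 0 < γ₀) (hle : γ₀ ≤ θ.γ) (hβ' : 0 ≤ β')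
    (hcont : letI := θ.instVβ₁; letI := θ.instVβ₂; letI := θ.instιβ
      ∀ k, ContinuousOn (betaMerged F (mergedTermFamilyMatT F N (TcanOfRecord F N) (chiFixed29 F N θ.ν θ.ε₂₉) θ.εbg) θ.ρ8 θ.bV k) (Box γ₀ k))
    (hhi : letI := θ.instVβ₁; letI := θ.instVβ₂; letI := θ.instιβ
      ∀ k (v : Fin (k + 1) → ℝ), v ∈ Box γ₀ k →
        betaMerged F (mergedTermFamilyMatT F N (TcanOfRecord F N) (chiFixed29 F N θ.ν θ.ε₂₉) θ.εbg) θ.ρ8 θ.bV k v ≤ β')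
    (hsign : letI := θ.instVβ₁; letI := θ.instVβ₂; letI := θ.instιβ
      ∀ (k : ℕ) (gs : ℕ → ℝ), (∀ i, i ≤ k → 0 < gs i ∧ gs i ≤ γ₀) → (∀ i j, i ≤ j → j ≤ k → gs i ≤ gs j) →
        0 ≤ betaMerged F (mergedTermFamilyMatT F N (TcanOfRecord F N) (chiFixed29 F N θ.ν θ.ε₂₉) θ.εbg) θ.ρ8 θ.bV k (prefixOf gs k)) :
    EndpointExistence (datumOfRecord₁₃Sep F N θ hP).C.toB12 ∧ ∃ γc : ℝ, 0 < γc ∧ BetaContH γc (datumOfRecord₁₃Sep F N θ hP).βfun :=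
  endpoint_and_n26_of_merged_cont_upper_sign₁₃ F N θ _ (βfun_datumOfRecord₁₃Sep F N θ hP) hγ₀ hle hβ' hcont hhi hsign

end AtRecordSep

/-! ## §3′ Instances at def-T's bg-free CORE datum `datumOfRecord₁₃Core θ hc` (`βfun_datumOfRecord₁₃Core`, `rfl`) — the LAST key: every item edition's datum (`…Sep`, `…SepMixed`, …)
is `datumOfRecord₁₃Core θ h.toCore` by `rfl` (def-T `datumOfRecord₁₃Sep_eq_core`; plan g67 CORE-YES 2026-08-27) -/

section AtRecordCore

variable (θ : Stage13Params F N)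

/-- **K2's consequent ∧ N26 at the CORE datum `datumOfRecord₁₃Core θ hc` from B4 + (U) + the sign on non-decreasing histories** (§1 (a)); applies at any item edition with
`hc := h.toCore`, datum by `rfl`. Instance 0∕1; N25 ∕ N26 NOT discharged. [cite: Balaban1987RG1, Thm 2 p.259 (first sentence); Balaban1989LargeFieldII, Thm 1 + (0.1) pp.355–356 (the record)] -/
theorem endpoint_and_n26_datumOfRecord₁₃Core_of_monotoneSign (hc : θ.Provisos₁₃Core F N) {γ₀ β' : ℝ} (hγ₀ : 0 < γ₀) (hβ' : 0 ≤ β')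
    (hcont : BetaContH γ₀ (betaOfRecord₁₃ F N θ)) (hhi : BetaUpperH β' γ₀ (betaOfRecord₁₃ F N θ))
    (hsign : ∀ (k : ℕ) (gs : ℕ → ℝ), (∀ i, i ≤ k → 0 < gs i ∧ gs i ≤ γ₀) → (∀ i j, i ≤ j → j ≤ k → gs i ≤ gs j) →
      0 ≤ betaOfRecord₁₃ F N θ k (prefixOf gs k)) :
    EndpointExistence (datumOfRecord₁₃Core F N θ hc).C.toB12 ∧ ∃ γc : ℝ, 0 < γc ∧ BetaContH γc (datumOfRecord₁₃Core F N θ hc).βfun :=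
  endpoint_and_n26_of_monotoneSign₁₃ F N θ _ (βfun_datumOfRecord₁₃Core F N θ hc) hγ₀ hβ' hcont hhi hsign

/-- **★ K2's consequent ∧ N26 at the CORE datum `datumOfRecord₁₃Core θ hc` from the three merged-β sentences on `]0,γ₀]^{k+1}`** (`0 < γ₀ ≤ θ.γ`; §2); applies at any item edition
with `hc := h.toCore`, datum by `rfl`. Instance 0∕1; N25 ∕ N26 NOT discharged. [cite: Balaban1987RG1, Thm 2 p.259 (first sentence), (0.31) p.259 and (1.20)–(1.22) p.264] -/
theorem endpoint_and_n26_datumOfRecord₁₃Core_of_merged_cont_upper_sign (hc : θ.Provisos₁₃Core F N) {γ₀ β' : ℝ} (hγ₀ : 0 < γ₀) (hle : γ₀ ≤ θ.γ) (hβ' : 0 ≤ β')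
    (hcont : letI := θ.instVβ₁; letI := θ.instVβ₂; letI := θ.instιβ
      ∀ k, ContinuousOn (betaMerged F (mergedTermFamilyMatT F N (TcanOfRecord F N) (chiFixed29 F N θ.ν θ.ε₂₉) θ.εbg) θ.ρ8 θ.bV k) (Box γ₀ k))
    (hhi : letI := θ.instVβ₁; letI := θ.instVβ₂; letI := θ.instιβ
      ∀ k (v : Fin (k + 1) → ℝ), v ∈ Box γ₀ k →
        betaMerged F (mergedTermFamilyMatT F N (TcanOfRecord F N) (chiFixed29 F N θ.ν θ.ε₂₉) θ.εbg) θ.ρ8 θ.bV k v ≤ β')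
    (hsign : letI := θ.instVβ₁; letI := θ.instVβ₂; letI := θ.instιβ
      ∀ (k : ℕ) (gs : ℕ → ℝ), (∀ i, i ≤ k → 0 < gs i ∧ gs i ≤ γ₀) → (∀ i j, i ≤ j → j ≤ k → gs i ≤ gs j) →
        0 ≤ betaMerged F (mergedTermFamilyMatT F N (TcanOfRecord F N) (chiFixed29 F N θ.ν θ.ε₂₉) θ.εbg) θ.ρ8 θ.bV k (prefixOf gs k)) :
    EndpointExistence (datumOfRecord₁₃Core F N θ hc).C.toB12 ∧ ∃ γc : ℝ, 0 < γc ∧ BetaContH γc (datumOfRecord₁₃Core F N θ hc).βfun :=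
  endpoint_and_n26_of_merged_cont_upper_sign₁₃ F N θ _ (βfun_datumOfRecord₁₃Core F N θ hc) hγ₀ hle hβ' hcont hhi hsign

end AtRecordCore

/-! ## §4 The ∀θ-form: the rev-18 ⁗ route text's body (N = 2) from the ∀θ merged sign-triple -/

section Route

/-- **K2⁗'s ∀θ-TEXT (its body verbatim at `N = 2`: provisos, unity bundle, admissibility, (B) at the separated-range datum, the window ⟹ `EndpointExistence`) FROM THE ∀θ MERGED
SIGN-TRIPLE** «at every admissible θ with separated-range provisos, on SOME box `0 < γ₀ ≤ θ.γ` with SOME `β' ≥ 0`: the merged β is per-`k` continuous, `≤ β'`, and `≥ 0` at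
non-decreasing histories».  The crux's unity, (B) and window hypotheses are unused on this road (as on the registered one).  A REDUCTION: the triple is NOT proved (instance
0∕1); K2⁗ NOT closed. [cite: Balaban1987RG1, Thm 2 p.259 (first sentence), (0.31) p.259 and (1.20)–(1.22) p.264] -/
theorem k2Consequent₁₃Sep_of_chainFreeSign
    (h : ∀ (F : T4Family) (θ : Stage13Params F 2) (_ : θ.Provisos₁₃Sep F 2), θ.Admissible F 2 →
      letI := θ.instVβ₁; letI := θ.instVβ₂; letI := θ.instιβ
      ∃ γ₀ β' : ℝ, 0 < γ₀ ∧ γ₀ ≤ θ.γ ∧ 0 ≤ β' ∧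
        (∀ k, ContinuousOn (betaMerged F (mergedTermFamilyMatT F 2 (TcanOfRecord F 2) (chiFixed29 F 2 θ.ν θ.ε₂₉) θ.εbg) θ.ρ8 θ.bV k) (Box γ₀ k)) ∧
        (∀ k (v : Fin (k + 1) → ℝ), v ∈ Box γ₀ k →
          betaMerged F (mergedTermFamilyMatT F 2 (TcanOfRecord F 2) (chiFixed29 F 2 θ.ν θ.ε₂₉) θ.εbg) θ.ρ8 θ.bV k v ≤ β') ∧
        (∀ (k : ℕ) (gs : ℕ → ℝ), (∀ i, i ≤ k → 0 < gs i ∧ gs i ≤ γ₀) → (∀ i j, i ≤ j → j ≤ k → gs i ≤ gs j) →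
          0 ≤ betaMerged F (mergedTermFamilyMatT F 2 (TcanOfRecord F 2) (chiFixed29 F 2 θ.ν θ.ε₂₉) θ.εbg) θ.ρ8 θ.bV k (prefixOf gs k))) :
    ∀ (F : T4Family) (θ : Stage13Params F 2) (hP : θ.Provisos₁₃Sep F 2), (θ.ZtUnity F 2 ∧ θ.SlotsNondegenerate₁₃ F 2) → θ.Admissible F 2 →
      B16.EndStatementBPrinted (datumOfRecord₁₃Sep F 2 θ hP).C →
      (∃ γ₁ : ℝ, 0 < γ₁ ∧ ∀ γ : ℝ, 0 < γ → γ ≤ γ₁ → ∃ P : B12.RunParams, 1 ≤ P.K ∧ ((datumOfRecord₁₃Sep F 2 θ hP).C P).flow.InInterval γ P.K) →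
      EndpointExistence (datumOfRecord₁₃Sep F 2 θ hP).C.toB12 := by
  intro F θ hP _ hθ _ _
  obtain ⟨γ₀, β', hγ₀, hle, hβ', hcont, hhi, hsign⟩ := h F θ hP hθ
  exact (endpoint_and_n26_datumOfRecord₁₃Sep_of_merged_cont_upper_sign F 2 θ hP hγ₀ hle hβ' hcont hhi hsign).1

end Route

end Summit.QuantumFields.YangMills.Theorems.BalabanUVNodesK2AtBetaOfRecord13ChainFree

end
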